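import Literature.NumberTheory.BeurlingPrimes.WellBehavedSystems
import Literature.NumberTheory.BeurlingPrimes.MergePowers
import Mathlib.Analysis.SpecialFunctions.Integrals.Basic
import HarnessLib

/-!
# `ψ_P(x) = Π_P(x) log x − ∫₁ˣ Π_P(u) du/u`: the Chebyshev function from Riemann's prime-counting function

Topic `Literature/NumberTheory/BeurlingPrimes`. Everything in this file is PROVED.

For a Beurling prime system `P` the barrier file defines `ψ_P(x) = Σ_{λ_j^k ≤ x} log λ_j` and
`WellBehavedSystems.lean` defines `Π_P(x) = riemannPrimeCount x = Σ_{λ_j^k ≤ x} 1/k`, both as `tsum`s of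
finitely supported families over `(j, k)`. Here:

* `riemannPrimeCount_eq_sum_of_le` — `Π_P(u)` is a finite sum over the tree's `psiSupport x` for every `u ≤ x`;
  `Π_P` is non-negative and monotone (`riemannPrimeCount_nonneg`, `riemannPrimeCount_mono`);
* `chebyshevPsi_eq_riemannPrimeCount_mul_log_sub_integral` — the Stieltjes/Abel identity
  `ψ_P(x) = ∫₁ˣ log u dΠ_P(u) = Π_P(x) log x − ∫₁ˣ Π_P(u) u⁻¹ du` (`x ≥ 1`), BDR §3: "Since
  `ψ_P(x) := ∫_1^x log u dΠ_P(u)` …", obtained termwise from `log q = log x − ∫_q^x du/u` for each prime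
  power `q = λ_j^k ≤ x` (weight `1/k`, and `(1/k) log λ_j^k = log λ_j`).

This is the bookkeeping that turns BV 2024's `Π_P(x) = Li(x) + O(log log x)` into
`ψ_P(x) = x + O(log x log log x)` (file `LiAbel.lean`).

## References
* [BrouckeDebruyneRevesz2023] F. Broucke, G. Debruyne, Sz. Gy. Révész, *Some examples of well-behaved Beurling
  number systems*, arXiv:2309.01567, §1 (`Π_𝒫`, `ψ_𝒫`) and proof of Theorem 3.2 ("`ψ_𝒫(x) := ∫_1^x log u dΠ_𝒫(u)`").
-/

noncomputable section

open Filter Set MeasureTheory intervalIntegral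
open scoped Topology

namespace Literature.NumberTheory.BeurlingPrimes

open Literature.Barriers.RiemannHypothesis

variable (P : BeurlingPrimes)

/-! ### `Π_P` as a finite sum -/

/-- The summands of `Π_P(u)` vanish outside `psiSupport x` whenever `u ≤ x`. [folklore] -/
theorem _root_.Literature.Barriers.RiemannHypothesis.BeurlingPrimes.piTerm_eq_zero_of_le {u x : ℝ} (hux : u ≤ x)
    {jk : ℕ × ℕ} (hjk : jk ∉ P.psiSupport x) :
    (if P.prime jk.1 ^ (jk.2 + 1) ≤ u then 1 / ((jk.2 : ℝ) + 1) else 0) = 0 := by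
  rw [if_neg]
  exact fun h ↦ hjk (P.mem_psiSupport (h.trans hux))

/-- **`Π_P(u)` is a finite sum** over `psiSupport x` for every `u ≤ x`:
`Π_P(u) = Σ_{(j,k) ∈ psiSupport x} (1/(k+1)) [λ_j^{k+1} ≤ u]`. [cite: BrouckeDebruyneRevesz2023, §1] -/
theorem _root_.Literature.Barriers.RiemannHypothesis.BeurlingPrimes.riemannPrimeCount_eq_sum_of_le {u x : ℝ}
    (hux : u ≤ x) : P.riemannPrimeCount u =
      ∑ jk ∈ P.psiSupport x, (if P.prime jk.1 ^ (jk.2 + 1) ≤ u then 1 / ((jk.2 : ℝ) + 1) else 0) :=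
  tsum_eq_sum fun _ hjk ↦ P.piTerm_eq_zero_of_le hux hjk

/-- `Π_P ≥ 0`. [folklore] -/
theorem _root_.Literature.Barriers.RiemannHypothesis.BeurlingPrimes.riemannPrimeCount_nonneg (x : ℝ) :
    0 ≤ P.riemannPrimeCount x := by
  rw [P.riemannPrimeCount_eq_sum_of_le le_rfl]
  exact Finset.sum_nonneg fun jk _ ↦ by split_ifs <;> positivity

/-- `Π_P` is non-decreasing. [folklore] -/
theorem _root_.Literature.Barriers.RiemannHypothesis.BeurlingPrimes.riemannPrimeCount_mono :
    Monotone P.riemannPrimeCount := by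
  intro u x hux
  rw [P.riemannPrimeCount_eq_sum_of_le hux, P.riemannPrimeCount_eq_sum_of_le le_rfl]
  refine Finset.sum_le_sum fun jk _ ↦ ?_
  by_cases h : P.prime jk.1 ^ (jk.2 + 1) ≤ u
  · rw [if_pos h, if_pos (h.trans hux)]
  · rw [if_neg h]
    split_ifs <;> positivity

/-- `Π_P` is measurable (it is monotone). [folklore] -/
theorem _root_.Literature.Barriers.RiemannHypothesis.BeurlingPrimes.measurable_riemannPrimeCount :
    Measurable P.riemannPrimeCount :=
  P.riemannPrimeCount_mono.measurable

/-- `Π_P` is interval integrable against `u⁻¹ du` on `[1, x]` (bounded by `Π_P(x)`, measurable). [folklore] -/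
theorem _root_.Literature.Barriers.RiemannHypothesis.BeurlingPrimes.intervalIntegrable_riemannPrimeCount_div
    {x : ℝ} (hx : 1 ≤ x) : IntervalIntegrable (fun u ↦ P.riemannPrimeCount u / u) volume 1 x := by
  rw [intervalIntegrable_iff_integrableOn_Ioc_of_le hx]
  have hconst : IntegrableOn (fun _ : ℝ ↦ P.riemannPrimeCount x) (Ioc 1 x) volume :=
    integrableOn_const measure_Ioc_lt_top.ne
  refine hconst.mono' ?_ ?_
  · exact (P.measurable_riemannPrimeCount.div measurable_id).aestronglyMeasurable
  · refine (ae_restrict_iff' measurableSet_Ioc).mpr (Eventually.of_forall fun u hu ↦ ?_)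
    rw [Real.norm_eq_abs, abs_div, abs_of_nonneg (P.riemannPrimeCount_nonneg u), abs_of_pos (by linarith [hu.1])]
    calc P.riemannPrimeCount u / u ≤ P.riemannPrimeCount u / 1 :=
          div_le_div_of_nonneg_left (P.riemannPrimeCount_nonneg u) one_pos hu.1.le
      _ ≤ P.riemannPrimeCount x := by rw [div_one]; exact P.riemannPrimeCount_mono hu.2

/-! ### The Abel step for one prime power -/

/-- `∫₁ˣ [q ≤ u] w u⁻¹ du = w (log x − log q)` for `1 < q ≤ x`. [folklore] -/
theorem integral_ite_div_eq {q w x : ℝ} (hq : 1 < q) (hqx : q ≤ x) :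
    ∫ u in (1 : ℝ)..x, (if q ≤ u then w else 0) / u = w * (Real.log x - Real.log q) := by
  have hx : (1 : ℝ) ≤ x := hq.le.trans hqx
  have hfun : (fun u : ℝ ↦ (if q ≤ u then w else 0) / u) = (Ici q).indicator fun u ↦ w / u := by
    funext u
    by_cases hu : q ≤ u
    · rw [if_pos hu, indicator_of_mem (show u ∈ Ici q from hu)]
    · rw [if_neg hu, indicator_of_notMem (show u ∉ Ici q from hu), zero_div]
  rw [hfun, integral_of_le hx, setIntegral_indicator measurableSet_Ici]
  have hset : Ioc 1 x ∩ Ici q = Icc q x := by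
    ext u
    simp only [mem_inter_iff, mem_Ioc, mem_Ici, mem_Icc]
    constructor
    · rintro ⟨⟨_, h2⟩, h3⟩; exact ⟨h3, h2⟩
    · rintro ⟨h1, h2⟩; exact ⟨⟨by linarith, h2⟩, h1⟩
  rw [hset, integral_Icc_eq_integral_Ioc, ← integral_of_le hqx]
  have h0 : (0 : ℝ) ∉ uIcc q x := by
    rw [uIcc_of_le hqx]; exact fun h ↦ by linarith [h.1]
  simp_rw [div_eq_mul_inv]
  rw [intervalIntegral.integral_const_mul, integral_inv h0, Real.log_div (by linarith) (by linarith)]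

/-- The integrand `[q ≤ u] w u⁻¹` is interval integrable on `[1, x]`. [folklore] -/
theorem intervalIntegrable_ite_div {q w x : ℝ} (hx : 1 ≤ x) :
    IntervalIntegrable (fun u : ℝ ↦ (if q ≤ u then w else 0) / u) volume 1 x := by
  have hfun : (fun u : ℝ ↦ (if q ≤ u then w else 0) / u) = (Ici q).indicator fun u ↦ w / u := by
    funext u
    by_cases hu : q ≤ u
    · rw [if_pos hu, indicator_of_mem (show u ∈ Ici q from hu)]
    · rw [if_neg hu, indicator_of_notMem (show u ∉ Ici q from hu), zero_div]
  rw [hfun]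
  refine IntegrableOn.intervalIntegrable ?_
  rw [uIcc_of_le hx]
  refine IntegrableOn.indicator ?_ measurableSet_Ici
  refine ContinuousOn.integrableOn_Icc (continuousOn_const.div continuousOn_id fun u hu ↦ ?_)
  exact ne_of_gt (lt_of_lt_of_le one_pos hu.1)

/-- The Abel step for one prime power `q = λ_j^{k+1}`: for every `x ≥ 1`,
`log λ_j · [q ≤ x] = (1/(k+1)) [q ≤ x] log x − ∫₁ˣ (1/(k+1)) [q ≤ u] u⁻¹ du`. [folklore] -/
theorem _root_.Literature.Barriers.RiemannHypothesis.BeurlingPrimes.psiTerm_eq_abel {x : ℝ} (hx : 1 ≤ x) (jk : ℕ × ℕ) :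
    P.psiTerm x jk = (if P.prime jk.1 ^ (jk.2 + 1) ≤ x then 1 / ((jk.2 : ℝ) + 1) else 0) * Real.log x -
      ∫ u in (1 : ℝ)..x, (if P.prime jk.1 ^ (jk.2 + 1) ≤ u then 1 / ((jk.2 : ℝ) + 1) else 0) / u := by
  set q : ℝ := P.prime jk.1 ^ (jk.2 + 1) with hq
  have hq1 : 1 < q := one_lt_pow₀ (P.one_lt_prime _) (Nat.succ_ne_zero _)
  unfold BeurlingPrimes.psiTerm
  by_cases hqx : q ≤ x
  · rw [if_pos hqx, if_pos hqx, integral_ite_div_eq hq1 hqx, hq, Real.log_pow]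
    push_cast
    have : ((jk.2 : ℝ) + 1) ≠ 0 := by positivity
    field_simp
    ring
  · rw [if_neg hqx, if_neg hqx, zero_mul, zero_sub]
    have h0 : ∫ u in (1 : ℝ)..x, (if q ≤ u then 1 / ((jk.2 : ℝ) + 1) else 0) / u = ∫ _ in (1 : ℝ)..x, (0 : ℝ) := by
      refine intervalIntegral.integral_congr fun u hu ↦ ?_
      rw [uIcc_of_le hx] at hu
      rw [if_neg (fun h ↦ hqx (h.trans hu.2)), zero_div]
    rw [h0, intervalIntegral.integral_zero, neg_zero]

/-! ### The identity -/

/-- **`ψ_P(x) = Π_P(x) log x − ∫₁ˣ Π_P(u) u⁻¹ du`** for `x ≥ 1` (`= ∫₁ˣ log u dΠ_P(u)`).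
[cite: BrouckeDebruyneRevesz2023, proof of Theorem 3.2] -/
theorem _root_.Literature.Barriers.RiemannHypothesis.BeurlingPrimes.chebyshevPsi_eq_riemannPrimeCount_mul_log_sub_integral
    {x : ℝ} (hx : 1 ≤ x) :
    P.chebyshevPsi x = P.riemannPrimeCount x * Real.log x - ∫ u in (1 : ℝ)..x, P.riemannPrimeCount u / u := by
  set s := P.psiSupport x with hs
  have hint : ∫ u in (1 : ℝ)..x, P.riemannPrimeCount u / u =
      ∫ u in (1 : ℝ)..x, ∑ jk ∈ s, (if P.prime jk.1 ^ (jk.2 + 1) ≤ u then 1 / ((jk.2 : ℝ) + 1) else 0) / u := by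
    refine intervalIntegral.integral_congr fun u hu ↦ ?_
    rw [uIcc_of_le hx] at hu
    rw [P.riemannPrimeCount_eq_sum_of_le hu.2, Finset.sum_div]
  rw [hint, intervalIntegral.integral_finsetSum fun jk _ ↦ intervalIntegrable_ite_div hx,
    P.riemannPrimeCount_eq_sum_of_le le_rfl, P.chebyshevPsi_eq_sum, Finset.sum_mul, ← Finset.sum_sub_distrib]
  exact Finset.sum_congr rfl fun jk _ ↦ P.psiTerm_eq_abel hx jk

end Literature.NumberTheory.BeurlingPrimes
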